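import Summits.CriticalPhenomena.PercolationContinuityZ3.Theorems.PercNearOneGluingNoHeavyQuantWindowExtremeNoTight
import Summits.CriticalPhenomena.PercolationContinuityZ3.Theorems.PercNearOneGluingNoHeavyQuantWindowExtremeTightGiant
import Summits.CriticalPhenomena.PercolationContinuityZ3.Theorems.PercNearOneGluingNoHeavyQuantWindowExtremeTight
import Summits.CriticalPhenomena.PercolationContinuityZ3.Theorems.PercNearOneGluingNoHeavyQuantFarTreeRowOfThree
import HarnessLib

/-!
# QUANT lane R8, T-DEC: **`WindowExtremeSmall` HOLDS — hence `WindowAtomDecomposition` HOLDS**: every window-DEC probability law on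
# `{0..M}` is a finite mixture of window-DEC laws with at most two lows and at most two absorbers of the top layer
# (statement (I) of README V279/V280; memo WINDOW-ATOMS-G57, file H5 part 7 — the assembly)

builds on p205010 (kernel theorem, internal audit signed; external expert review pending)

Proof file (`--supports stmt-CriticalPhenomena-4575`), QUANT lane seat prim-quant-census-2 (gen 57), rung R8 of
`run/shared/lean/prim/quant/LADDER.md`.  Theorems only, standard axioms, no sorries.

THE PROOF (memo §2; this lane's files `…QuantCornerPrefix`, `…QuantWindowWitness`, `…QuantWindowPerturbLaw/Perturb`, `…QuantWindowPieces`,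
`…QuantWindowTwoSided`, `…QuantWindowExtremePieces/NoTight/TightGiant/Tight`).  For an extreme point `v` of the window polytope, let
`J*` be the largest unflipped window layer whose giant pool is nonempty and exactly saturated by the truncated top corner run (the
corner theorem `cornerTheorem_holds` and the prefix property `cornerLeftover_prefix` make this the right notion of "tight").  Beyond `J*`
there are always two elementary pieces (a corner segment `e_l + c·e_h`, an absorber point, a leftover low, a giant above `j`) — or one whose
pool change vanishes — and the corresponding combination is a two-sided move inside the polytope (`exists_oneSided` twice: unflipped layers
by the perturbed witness `flowAtT_pert`, flipped layers by the strict all-giant inequality `allGiant_gap`, smallness by `∀ᶠ η in 𝓝[>] 0`).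
At an extreme point the move is proportional to the law, so the law's support lies in the ≤ 2 lows and ≤ 2 absorbers named by the pieces
(`smallLaw_of_pieces`).  Without a saturated layer a single piece does it (`smallLaw_of_noTight`).

* **`LawDec.windowExtremeSmall_holds : WindowExtremeSmall`**.
* **`LawDec.windowAtomDecomposition_holds : WindowAtomDecomposition`** (with the Krein–Milman reduction `windowAtomDecomposition_of_extremeSmall`).
* `LawDec.convClosedT_of_residue : ConvClosedTResidue → ConvClosedT`, `LawDec.treeBuiltDEC_of_two`, `Quant.treeDEC_of_two`,
  **`Quant.farTreeRow_of_two : LawDec.ConvClosedTResidue → LawDec.GatedConvEmptyFree → FarTreeRow`** — the R8 law level now rests on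
  the two statements (II) and (III) (lead g24's `farTreeRow_of_three` with (I) discharged).

HONEST STATUS: (I) is a THEOREM; (II) `ConvClosedTResidue`, (III) `GatedConvEmptyFree`, hence `ConvClosedT`, `SDECConvClosed`, `TreeBuiltDEC`,
`TreeDEC`, `FarTreeRow` remain OPEN.  [this work]; nothing here is cited as a published result.  The gluing rows served
[cite: KozmaNitzan2024, Conjecture 3 (p. 15)]; product measure [cite: Grimmett1999, §1.3 p. 10].
-/

noncomputable section

namespace Summit.CriticalPhenomena.PercolationContinuityZ3.Theorems

namespace Quant

open Finset

namespace LawDec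

/-- **EXTREME POINTS OF THE WINDOW POLYTOPE ARE SMALL** (census-2 g57; memo WINDOW-ATOMS-G57 §2). [this work] -/
theorem windowExtremeSmall_holds : WindowExtremeSmall := by
  intro x T M j w v hx0 hx1 hvext
  classical
  -- the saturated ("tight") unflipped window layers
  set Tgt : Finset ℕ := (Finset.range (j + 1)).filter (fun J => j ≤ J + w ∧
      (∀ l, J < l → l ≤ j → 2 * (l : ℝ) < T → vecLaw M v l = 0) ∧
      x / (1 - x) * windowS x T j M (vecLaw M v) J = ∑ h ∈ Finset.Ico (J + 1) (M + 1), vecLaw M v h ∧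
      0 < ∑ h ∈ Finset.Ico (J + 1) (M + 1), vecLaw M v h) with hTgt
  by_cases hne : Tgt.Nonempty
  · -- the largest saturated layer
    have hJs : Tgt.max' hne ∈ Tgt := Finset.max'_mem _ _
    obtain ⟨-, -, hgap, hS, hΓ⟩ := Finset.mem_filter.1 hJs
    have hmax : ∀ J, J ≤ j → j ≤ J + w → (∀ l, J < l → l ≤ j → 2 * (l : ℝ) < T → vecLaw M v l = 0) →
        x / (1 - x) * windowS x T j M (vecLaw M v) J = ∑ h ∈ Finset.Ico (J + 1) (M + 1), vecLaw M v h →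
        0 < ∑ h ∈ Finset.Ico (J + 1) (M + 1), vecLaw M v h → J ≤ Tgt.max' hne :=
      fun J h1 h2 h3 h4 h5 =>
        Finset.le_max' _ _ (Finset.mem_filter.2 ⟨Finset.mem_range.2 (Nat.lt_succ_of_le h1), h2, h3, h4, h5⟩)
    by_cases hgiant : ∃ g, j < g ∧ g ≤ M ∧ vecLaw M v g ≠ 0
    · obtain ⟨g, hjg, hgM, hgne⟩ := hgiant
      exact smallLaw_of_tight_giant x T M j w v hx0 hx1 hvext (Tgt.max' hne) hS hΓ hmax g hjg hgM hgne
    · push Not at hgiant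
      exact smallLaw_of_tight_noGiant x T M j w v hx0 hx1 hvext (Tgt.max' hne) hgap hS hΓ hmax hgiant
  · -- no saturated layer
    have hno : ∀ J, J ≤ j → j ≤ J + w → (∀ l, J < l → l ≤ j → 2 * (l : ℝ) < T → vecLaw M v l = 0) →
        x / (1 - x) * windowS x T j M (vecLaw M v) J = ∑ h ∈ Finset.Ico (J + 1) (M + 1), vecLaw M v h →
        0 < ∑ h ∈ Finset.Ico (J + 1) (M + 1), vecLaw M v h → False :=
      fun J h1 h2 h3 h4 h5 => hne ⟨J, Finset.mem_filter.2 ⟨Finset.mem_range.2 (Nat.lt_succ_of_le h1), h2, h3, h4, h5⟩⟩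
    exact smallLaw_of_noTight x T M j w v hx0 hx1 hvext hno

/-- **`WindowAtomDecomposition` HOLDS** (statement (I) of README V279/V280): every window-DEC probability law on `{0..M}` is a finite
mixture of window-DEC laws that are SMALL at `(T, j)`. [this work] -/
theorem windowAtomDecomposition_holds : WindowAtomDecomposition :=
  windowAtomDecomposition_of_extremeSmall windowExtremeSmall_holds

/-- **`ConvClosedT` ⟸ its two-sided light-straddler residue (II)** — (I) discharged. [this work] -/
theorem convClosedT_of_residue (hII : ConvClosedTResidue) : ConvClosedT :=
  convClosedT_of_atoms_residue windowAtomDecomposition_holds hII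

/-- **(II) ∧ (III) ⟹ `SDECConvClosed`** — (I) discharged in lead g24's `sdecConvClosed_of_three`. [this work] -/
theorem sdecConvClosed_of_two (hII : ConvClosedTResidue) (hIII : GatedConvEmptyFree) : SDECConvClosed :=
  sdecConvClosed_of_three windowAtomDecomposition_holds hII hIII

/-- **(II) ∧ (III) ⟹ `TreeBuiltDEC`**. [this work] -/
theorem treeBuiltDEC_of_two (hII : ConvClosedTResidue) (hIII : GatedConvEmptyFree) : TreeBuiltDEC :=
  treeBuiltDEC_of_three windowAtomDecomposition_holds hII hIII

end LawDec

/-- **(II) ∧ (III) ⟹ `Quant.TreeDEC`**. [this work] -/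
theorem treeDEC_of_two (hII : LawDec.ConvClosedTResidue) (hIII : LawDec.GatedConvEmptyFree) : TreeDEC :=
  treeDEC_of_three LawDec.windowAtomDecomposition_holds hII hIII

/-- **(II) ∧ (III) ⟹ `Quant.FarTreeRow`** — FAR on trees from the two remaining finite-type law-level statements.  CONDITIONAL: (II) and
(III) are `@[conjecture]`. [this work] -/
theorem farTreeRow_of_two (hII : LawDec.ConvClosedTResidue) (hIII : LawDec.GatedConvEmptyFree) : FarTreeRow :=
  farTreeRow_of_three LawDec.windowAtomDecomposition_holds hII hIII

end Quant

end Summit.CriticalPhenomena.PercolationContinuityZ3.Theorems
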